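import Summits.ResolutionOfSingularities.ResolutionOfSingularities.Theorems.EquisingularLiftEquisingularLiftNatNoseTowerRoot
import Summits.ResolutionOfSingularities.ResolutionOfSingularities.Theorems.EquisingularLiftEquisingularLiftNatCentreCodimTwo
import Summits.ResolutionOfSingularities.ResolutionOfSingularities.Theorems.EquisingularLiftEquisingularLiftNatStalkDimension
import Summits.ResolutionOfSingularities.ResolutionOfSingularities.Theorems.EquisingularLiftEquisingularLiftNatModelStep
import Summits.ResolutionOfSingularities.ResolutionOfSingularities.Theorems.EquisingularLiftEquisingularLiftChainRegular
import HarnessLib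

/-!
# [OURS · L1 W4.5(b) · EL♮(3)] N1′ — THE NOSE ROOT MODULO ONE FIBRE DATUM: `DirLift.Ruled` at `(X', C)` from «`Z̃` is a curve»
# (N1 `DirLift.ruled_noseRoot` p568062 with its `hcodim` binder DISCHARGED by res-L1-w45b-stub-3's T-DIM-CENTRE p568469 in the K5′ frame of
# res-D-pv-018's nose assembly `hsub_reachNoseTower_three_of`; rung NOSE-TOWER₃ of `stub_elnat_ratNoseTowerResolution`,
# crux `EquisingularLiftNatThree` = stmt-ResolutionOfSingularities-20148, parent stmt-…-20038)

res-D-pv-035 g9 (D hand AS w45b; object N1 `hRootNose` DISCHARGE, res-L1-w45b-plan-1 NAMING 2026-08-27T20:19:50Z — its sharpening after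
T-DIM-CENTRE landed). OURS — planning vocabulary of the crux chain w45b (cell `res-hironaka`, slot W4.5(b)); NOT a statement of H. Hironaka's
manuscript or of any paper; AI-written, weaker than expert review. No `sorry`; standard axioms; DEF-FREE.
`--supports stmt-ResolutionOfSingularities-20148 --as helper`.

WHAT. N1 (`DirLift.ruled_noseRoot`, …NatNoseTowerRoot) produces the nose assembly's stand-in `hRootNose` from the nose block modulo two
named inputs, `hcodim` (codimension two of the centre `C` at every point of its support) and `hCrat` (residue (T-j)). Inside the K5′ frame
of the assembly (`O` a DVR with `θ : O ↠ k`; `q : P → Spec O` proper and smooth of relative dimension `n` with `P` integral, locally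
Noetherian, regular; `Y ⊆ P` irreducible closed; the stage `(X', σ', S')` a `Split.Chain` stage — hence `σ'` PROPER (`chain_isRegular`) and
T-DIM `dim 𝒪_{X',b} = n + 1` at the closed points `b` over the closed point of `O` (`ringKrullDim_stalk_eq_succ_of_chain`, p513633)) the
clause `hcodim` REDUCES, by res-L1-w45b-stub-3's `forall_codim_two_of_model` / `compactSpace_and_apply_eq_closedPoint_of_isProper`
(…NatCentreCodimTwo, p568469: flatness of `V(C)` over `O` + the reduced special fibre `C·𝒪_{F₁} = 𝓘⟨Z⟩` + generization), to ONE FIBRE DATUM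
in the carrier's own currency:
  `hdimZ : dim 𝒪_{Z̃,z} = n - 2` at the closed points `z` of the reduced carrier `Z̃ = redSub F₁ Z hZ = V(𝓘⟨Z⟩)`
(«`Z` is a curve» when `n = 3`; at the nose `Z` is the double curve of the surface, so the INST side reads it off its construction).
* **`DirLift.ruled_noseRoot_of_dimZ`** — `hRootNose`'s type VERBATIM, from the K5′ frame + the nose block + `hdimZ` + `hCrat`;
* **`Tower.inv₂_noseSeed_root_of_dimZ'`** — the (seed) clause of `hsub_reachNoseTower_three_of` (res-D-pv-035's `Tower.inv₂_noseSeed'`,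
  p565384, with the assembly's three side conjuncts at `K = ∅`) with `hRuled` discharged likewise: stand-in-free modulo `hdimZ`, `hCrat`.

References (OURS, index only): res-D-pv-035 …NatNoseTowerRoot (N1, p568062) / …NatNoseTowerSeed (p565384); res-L1-w45b-stub-3 …NatCentreCodimTwo
(p568469) / …NatCentreTwoFrame (p564791); res-L1-w45b-stub-2 …NatTowerRuledRoots (p562947); res-D-pv-013 …NatStalkDimension (T-DIM p513633);
`chain_isRegular` (…ChainRegular); res-type-100 …NatModelStep (model-square range lemmas); res-D-pv-018 …NatNoseTowerAssembly (p567798).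
[cite: Matsumura1987, Thm. 14.2, Thm. 15.1, Thm. 16.2] [cite: Liu2002, Thm. 8.1.19] [cite: StacksProject, Tag 01J7] (all via the cited tree files).
-/

set_option linter.dupNamespace false -- mandated namespace `Summit.<Summit>.<Problem>` of this single-conjunct summit
set_option linter.overlappingInstances false -- signatures carry `[IsDomain O] [IsDiscreteValuationRing O]`

noncomputable section

open CategoryTheory CategoryTheory.Limits AlgebraicGeometry TopologicalSpace Topology IsLocalRing
open Literature.AlgebraicGeometry.Resolution
open Literature.AlgebraicGeometry.Morphisms (ProjCech.PP ProjCech.toSpec)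
open AlgebraicGeometry.Scheme.IdealSheafData
open Summit.ResolutionOfSingularities.ResolutionOfSingularities.Theses.EquisingularLift.Split
open Summit.ResolutionOfSingularities.ResolutionOfSingularities.Cruxes.EquisingularLift.StrataSplit

namespace Summit.ResolutionOfSingularities.ResolutionOfSingularities.Cruxes.EquisingularLiftNat.Sections

/-- **N1′ — the nose root carries `DirLift.Ruled`, modulo «`Z̃` has dimension `n - 2` at its closed points» and `hCrat`.** In the K5′
frame (see the module docstring) and the nose block of HSUB′(ReachNoseTower₃), the exceptional surface `C·𝒪_{X₁}` carries
res-L1-w45b-stub-2's ruled-surface datum at the seed stage — the type of res-D-pv-018's stand-in `hRootNose`, verbatim — given only the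
fibre datum `hdimZ` on the reduced carrier `Z̃ = redSub F₁ Z hZ` and the conditional upstairs rationality `hCrat` of `C`: N1's `hcodim` is
discharged by res-L1-w45b-stub-3's T-DIM-CENTRE from the flatness of `V(C)`, T-DIM on the `Split.Chain` stage `X'` and the properness of
`σ' ≫ q`. [cite: Matsumura1987, Thm. 14.2, Thm. 15.1, Thm. 16.2] [cite: StacksProject, Tag 01J7] [OURS · L1 W4.5b · pure composition of
p568062, p568469, p513633] toward `stub_elnat_ratNoseTowerResolution` (stmt-ResolutionOfSingularities-20148); NOT a statement of the manuscript. -/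
theorem DirLift.ruled_noseRoot_of_dimZ (O : Type) [CommRing O] [IsDomain O] [IsDiscreteValuationRing O] (k : Type) [Field k]
    (θ : O →+* k) (hθ : Function.Surjective θ)
    (P : Scheme.{0}) (q : P ⟶ Spec (.of O)) (Y : Set P)
    (hYirr : IsIrreducible Y) (hYcl : IsClosed Y) (hPint : IsIntegral P) (hPnoeth : IsLocallyNoetherian P)
    (hPreg : Scheme.IsRegular P) (hqprop : IsProper q) {n : ℕ} (hqsm : SmoothOfRelativeDimension n q)
    -- the stage before the nose — a `Split.Chain` stage — and its model
    (X' : Scheme.{0}) (σ' : X' ⟶ P) (S' : Set X') (hch : Chain P Y X' σ' S') (hX'int : IsIntegral X')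
    (hX'noeth : IsLocallyNoetherian X') (hX'reg : Scheme.IsRegular X')
    (F₁ : Scheme.{0}) (j : F₁ ⟶ X') (t : F₁ ⟶ Spec (.of k)) (hsq : IsPullback j t (σ' ≫ q) (Spec.map (CommRingCat.ofHom θ)))
    -- the nose block
    (Z : Set F₁) (hZ : IsClosed Z)
    (C : X'.IdealSheafData) (hCreg : Scheme.IsRegular C.subscheme) (hCfl : Flat (C.subschemeι ≫ σ' ≫ q))
    (hCj : C.comap j = vanishingIdeal (⟨Z, hZ⟩ : Closeds F₁))
    (hCoff : ∀ c ∈ (C.support : Set X'), ¬ IsGenericPoint (σ' c) Y)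
    (X₁ : Scheme.{0}) (τ₁ : X₁ ⟶ X') (hτ₁ : IsBlowup τ₁ C)
    (F₂ : Scheme.{0}) (υ : F₂ ⟶ F₁) (hυ : IsBlowup υ (vanishingIdeal (⟨Z, hZ⟩ : Closeds F₁)))
    (j₂ : F₂ ⟶ X₁) (t₂ : F₂ ⟶ Spec (.of k)) (hsq₂ : IsPullback j₂ t₂ ((τ₁ ≫ σ') ≫ q) (Spec.map (CommRingCat.ofHom θ)))
    (hcomm : j₂ ≫ τ₁ = υ ≫ j)
    -- (R3) input, reduced to ONE fibre datum: the reduced carrier has dimension `n - 2` at its closed points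
    {d : ℕ} (hnd : n = d + 2)
    (hdimZ : ∀ z : ↥(redSub F₁ Z hZ), IsClosed ({z} : Set ↥(redSub F₁ Z hZ)) →
      IsClosed ({j (redSubι F₁ Z hZ z)} : Set X') → ringKrullDim ((redSub F₁ Z hZ).presheaf.stalk z) = (d : WithBot ℕ∞))
    -- (R4) input — conditional upstairs rationality of the centre (residue (T-j); here a binder)
    (hCrat : RationalCarrier (redSub F₁ Z hZ) →
      ∃ e₁ : C.subscheme ≅ ProjCech.PP O 1, e₁.hom ≫ ProjCech.toSpec O 1 = C.subschemeι ≫ σ' ≫ q) :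
    DirLift.Ruled O k θ P q Y F₁ Z hZ F₂ υ F₂ (𝟙 F₂) (υ ⁻¹' Z) X₁ (τ₁ ≫ σ') j₂ (C.comap τ₁) := by
  haveI := hPint
  haveI := hPnoeth
  haveI := hqprop
  haveI := hqsm
  haveI := hX'noeth
  haveI := hCfl
  -- the stage is proper over `O` (blow-ups of the proper `P`)
  obtain ⟨-, -, hσ'⟩ := chain_isRegular P Y X' σ' S' hch hPnoeth hPreg
  haveI := hσ'
  haveI : IsProper (σ' ≫ q) := inferInstance
  -- T-DIM at the closed points of the special fibre: `dim 𝒪_{X',b} = n + 1`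
  have hξ : IsGenericPoint hYirr.genericPoint Y := hYirr.isGenericPoint_genericPoint hYcl
  have hdimX : ∀ z : ↥(redSub F₁ Z hZ), IsClosed ({j (redSubι F₁ Z hZ z)} : Set X') →
      (σ' ≫ q) (j (redSubι F₁ Z hZ z)) = closedPoint O →
      ringKrullDim (X'.presheaf.stalk (j (redSubι F₁ Z hZ z))) = ((n + 1 : ℕ) : WithBot ℕ∞) :=
    fun z hzcl hzs => ringKrullDim_stalk_eq_succ_of_chain q n hξ hch hzcl hzs
  -- T-DIM-CENTRE: `hcodim` on the whole support of `C`
  obtain ⟨hcpt, hsp⟩ := compactSpace_and_apply_eq_closedPoint_of_isProper O (σ' ≫ q)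
  haveI := hcpt
  have hcodim : ∀ x ∈ C.support, ringKrullDim (X'.presheaf.stalk x ⧸ stalkIdeal C x) + 2 = ringKrullDim (X'.presheaf.stalk x) :=
    forall_codim_two_of_model O k θ hθ (σ' ≫ q) j t hsq hX'reg C hCreg hCj (fun y _ hy => hsp y hy) hnd hdimX hdimZ
  exact DirLift.ruled_noseRoot O k θ P q Y X' σ' hX'int hX'noeth hX'reg F₁ j t hsq Z hZ C hCreg hCfl hCj hCoff X₁ τ₁ hτ₁ F₂ υ hυ
    j₂ t₂ hsq₂ hcomm hcodim hCrat

/-- **The (seed) clause of the nose assembly, stand-in-free modulo `hdimZ` and `hCrat`**: res-D-pv-035's `Tower.inv₂_noseSeed'`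
(p565384) — `Tower.Inv₂` on the nose seed `(F₂, 𝟙, closure υ⁻¹(T₁ ∖ Z), υ⁻¹ Z, ∅)` for `Ruled := DirLift.Ruled O k θ P q Y` with the
assembly's three side conjuncts at `K = ∅` — with `hRuled` supplied by `DirLift.ruled_noseRoot_of_dimZ`. [cite: GortzWedhorn2020, Prop. 13.91]
[cite: Liu2002, Thm. 8.1.19] [OURS · L1 W4.5b · pure composition] toward `stub_elnat_ratNoseTowerResolution` via `hsub_reachNoseTower_three_of`
(seed); NOT a statement of the manuscript. -/
theorem Tower.inv₂_noseSeed_root_of_dimZ' (O : Type) [CommRing O] [IsDomain O] [IsDiscreteValuationRing O] (k : Type) [Field k]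
    (θ : O →+* k) (hθ : Function.Surjective θ)
    (P : Scheme.{0}) (q : P ⟶ Spec (.of O)) (Y : Set P) (Ch : ∀ X' : Scheme.{0}, (X' ⟶ P) → Set X' → Prop)
    (hChSplit : ∀ (X' : Scheme.{0}) (σ' : X' ⟶ P) (S' : Set X'), Ch X' σ' S' → Chain P Y X' σ' S')
    (hYirr : IsIrreducible Y) (hYcl : IsClosed Y) (hPint : IsIntegral P) (hPnoeth : IsLocallyNoetherian P)
    (hPreg : Scheme.IsRegular P) (hqprop : IsProper q) {n : ℕ} (hqsm : SmoothOfRelativeDimension n q)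
    (X' : Scheme.{0}) (σ' : X' ⟶ P) (S' : Set X') (hCh' : Ch X' σ' S') (hX'int : IsIntegral X')
    (hX'noeth : IsLocallyNoetherian X') (hX'reg : Scheme.IsRegular X')
    (F₁ : Scheme.{0}) (j : F₁ ⟶ X') (t : F₁ ⟶ Spec (.of k)) (hsq : IsPullback j t (σ' ≫ q) (Spec.map (CommRingCat.ofHom θ)))
    (T₁ : Set F₁)
    (Z : Set F₁) (hZ : IsClosed Z) (hT₁Z : ¬ T₁ ⊆ Z) (hZinf : Z.Infinite)
    (C : X'.IdealSheafData) (hCreg : Scheme.IsRegular C.subscheme) (hCfl : Flat (C.subschemeι ≫ σ' ≫ q))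
    (hCj : C.comap j = vanishingIdeal (⟨Z, hZ⟩ : Closeds F₁))
    (hCoff : ∀ c ∈ (C.support : Set X'), ¬ IsGenericPoint (σ' c) Y)
    (X₁ : Scheme.{0}) (τ₁ : X₁ ⟶ X') (hτ₁ : IsBlowup τ₁ C) (hX₁int : IsIntegral X₁) (hX₁noeth : IsLocallyNoetherian X₁)
    (hX₁reg : Scheme.IsRegular X₁) (hX₁dom : IsDominant ((τ₁ ≫ σ') ≫ q))
    (F₂ : Scheme.{0}) (hF₂ : IsIntegral F₂) (υ : F₂ ⟶ F₁) (hυ : IsBlowup υ (vanishingIdeal (⟨Z, hZ⟩ : Closeds F₁)))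
    (j₂ : F₂ ⟶ X₁) (t₂ : F₂ ⟶ Spec (.of k)) (hsq₂ : IsPullback j₂ t₂ ((τ₁ ≫ σ') ≫ q) (Spec.map (CommRingCat.ofHom θ)))
    (hcomm : j₂ ≫ τ₁ = υ ≫ j) (hirr₂ : IsIrreducible (closure (υ ⁻¹' (T₁ \ Z))))
    (hCh₁ : Ch X₁ (τ₁ ≫ σ') (j₂ '' closure (υ ⁻¹' (T₁ \ Z))))
    -- the two remaining named inputs
    {d : ℕ} (hnd : n = d + 2)
    (hdimZ : ∀ z : ↥(redSub F₁ Z hZ), IsClosed ({z} : Set ↥(redSub F₁ Z hZ)) →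
      IsClosed ({j (redSubι F₁ Z hZ z)} : Set X') → ringKrullDim ((redSub F₁ Z hZ).presheaf.stalk z) = (d : WithBot ℕ∞))
    (hCrat : RationalCarrier (redSub F₁ Z hZ) →
      ∃ e₁ : C.subscheme ≅ ProjCech.PP O 1, e₁.hom ≫ ProjCech.toSpec O 1 = C.subschemeι ≫ σ' ≫ q) :
    Tower.Inv₂ O k θ P q Y Ch (DirLift.Ruled O k θ P q Y) F₁ Z hZ F₂ υ F₂ (𝟙 F₂) (closure (υ ⁻¹' (T₁ \ Z))) (υ ⁻¹' Z) ∅ ∧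
      IsClosed (∅ : Set F₂) ∧ (∅ : Set F₂) ⊆ closure (∅ \ υ ⁻¹' Z) ∧ (∅ : Set F₂) ≠ Set.univ :=
  Tower.inv₂_noseSeed' O k θ hθ P q Y Ch (DirLift.Ruled O k θ P q Y) X' σ' hX'noeth hX'reg F₁ j t hsq T₁ Z hZ hT₁Z hZinf C hCreg hCj
    hCoff X₁ τ₁ hτ₁ hX₁int hX₁noeth hX₁reg hX₁dom F₂ hF₂ υ hυ j₂ t₂ hsq₂ hcomm hirr₂ hCh₁
    (DirLift.ruled_noseRoot_of_dimZ O k θ hθ P q Y hYirr hYcl hPint hPnoeth hPreg hqprop hqsm X' σ' S' (hChSplit X' σ' S' hCh')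
      hX'int hX'noeth hX'reg F₁ j t hsq Z hZ C hCreg hCfl hCj hCoff X₁ τ₁ hτ₁ F₂ υ hυ j₂ t₂ hsq₂ hcomm hnd hdimZ hCrat)

end Summit.ResolutionOfSingularities.ResolutionOfSingularities.Cruxes.EquisingularLiftNat.Sections

end
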